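import Summits.QuantumFields.YangMills.Theorems.BalabanUVNodesN15BackgroundStep

/-!
# Route «BalabanUVNodes» (K4 «SpineRates»), node N15 = NE2, BACKGROUND LAYER — THE OTHER THREE ENTRIES OF THE BACKGROUND STEP: sources other than
# `G₁` (the `G∇*` entry) and DERIVED entries `Y = D₁ + (D₁V)X` (the `∇G` and `ΔG` entries), without differentiating a pulled-back function

Cell `pub-ymgap`, seat `pub-ymgap-dag-n15-b` (D-0062; `bears_on: R4∕N15`; `--supports stmt-QuantumFields-19351 --as helper`).  THEOREMS ONLY; imports this seat's
`…N15.BackgroundStep` (p409422 ✓) and through it `T4EtaRateDefect` BY NAME.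

THE POINT.  The node's first conjunct `NE2PlusOperator` asks for ALL FOUR sup entries of [Balaban1985BackgroundPropagators] Thm 3.1 (3.42) p. 397
(*«|(G′λ)(x)|, |(∇_U G′λ)(x)|, |(G′∇*_U λ)(x)|, |(Δ_U G′λ)(x)|»*) for the η-DIFFERENCE of the two runs' background propagators.  `…N15.BackgroundStep`
treats entry 0: `X = G(U)` as the fixed point `X = G₁ + (G₁V)X` ((3.64)∕(3.65) shape).  For the derivative entries one must NOT differentiate the defect
`𝔇(X′, X) = X′τ − τX` on the fine lattice — the piecewise-constant pull-back has jumps of relative size one at the block faces (`…N15.DerivDefect`: `χ = M·1_face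
− 1`), and the Leibniz split at the OUTER derivative produces two large cancelling pieces.  Instead each entry is its own object with its own (3.42)
kernel (King's convention, CMP 102 (1986) (3.73) p. 665: `∂G` is a separate kernel with a separate rate):
* entry 2, `Z = X∇* = G₁∇* + (G₁V)Z` — the SAME step with another SOURCE `S = G₁∇*`: §1 `idef_source_step_majorant` (the background step of
  `…N15.BackgroundStep` with an arbitrary source `S`, `S′` whose own `U ≡ 1` defect `𝔇(S′,S)` is a binder: NE2⁰'s third entry);
* entries 1 and 3, `Y = PX = D₁ + (D₁V)X` with `D₁ = PG₁` (`P = ∇` or `Δ`, the coarse run's; `D₁′ = P′G₁′`) — NOT a fixed point in `Y`; §2 the EXACT identity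
  `idef_derived_entry_eq`: `𝔇(Y′, Y) = 𝔇(D₁′,D₁) + 𝔇(D₁′,D₁)∘(VX) + (D₁′V′)∘𝔇(X′,X) + D₁′∘𝔇(V′,V)∘X`, and §3 its majorant `idef_derived_entry_majorant`:
  `(m_D + κm_D A_V C + κ′m_{DV}c_X + c_{DV})·e^{−ρd}·w(y′)` from the `U ≡ 1` defect of the derived entry (`𝔇(D₁′,D₁)`, NE2⁰'s entry 1∕3, binder),
  the coarse `VX`, the fine `D₁′V′` (SHAPE (3.63) with the derivative entry), the entry-0 defect `𝔇(X′,X)` (= `idef_background_propagator_majorant`'s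
  OUTPUT, constant `c_X`) and the SANDWICHED perturbation defect with left factor `D₁′` — whose adjoint-derivative entry `D₁′∇′* = ∇′G₁′∇′*` is the printed
  (3.44)-SHAPED quantity *«|(∇_U G′∇*_U λ)(x)|»* (p. 397; for `P = Δ` an L²-type entry of (3.46)) — supplied by this seat's `…N15FirstOrderDefect`.
With `…N15.BackgroundStep` (entry 0), §1 (entry 2) and §3 (entries 1, 3) all four entry operators of the background propagator's η-difference have
source-weighted block majorants from NE2⁰'s four entries + letters; the generic readout `…N15.OperatorReadout.ne2PlusOperator_of_hasMaj` then gives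
the node's first conjunct BY NAME (the uniform-constants bookkeeping is the consumer's).

HONEST FRAMING ∕ LIMITS.  MECHANISM ONLY: [folklore] bookkeeping over binders; (3.42)∕(3.44)∕(3.46)∕(3.63) are SHAPES; no Neumann series beyond §1; no instance
against [B6]∕[B9]'s operators (S6 of the record NOT attempted).  NE2⁺ NOT PRINTED, NOT proved; count-neutral (typed 28∕28 · discharged 0∕28); one finite T⁴ at
fixed ε — NOT infinite volume, NOT OS on ℝ⁴, NOT a mass gap, NOT Clay.
-/

noncomputable section

namespace Summit.QuantumFields.YangMills.BalabanUVNodes.N15.BackgroundStep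

open Literature.MathematicalPhysics.QuantumFieldTheory.Balaban1983to89
open Literature.MathematicalPhysics.QuantumFieldTheory.Balaban1983to89.B11SectG (BlockNorm HasMaj hasMaj_comp)
open Literature.MathematicalPhysics.QuantumFieldTheory.Balaban1983to89.T4EtaRateDefect (idef idef_fix idef_comp idef_add wnorm
  hasMaj_wnorm_iff hasMaj_comp_transfer hasMaj_comp_wrow_source SlowWeight slowWeight_const)
open Literature.MathematicalPhysics.QuantumFieldTheory.Balaban1983to89.B9SectDWeightedNeumann (WRow neumann_majorant_wrow)
open Literature.MathematicalPhysics.QuantumFieldTheory.Balaban1983to89.B6RandomWalk (Triangle254)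

variable {g : B6.Geometry}
variable {F₁ F₂ F₃ F₁' F₂' F₃' : Type} [AddCommGroup F₁] [Module ℝ F₁] [AddCommGroup F₂] [Module ℝ F₂] [AddCommGroup F₃] [Module ℝ F₃]
  [AddCommGroup F₁'] [Module ℝ F₁'] [AddCommGroup F₂'] [Module ℝ F₂'] [AddCommGroup F₃'] [Module ℝ F₃']

/-! ## §1 The background step with an arbitrary source (entry 2: `S = G₁∇*`) -/

/-- **THE BACKGROUND STEP WITH AN ARBITRARY SOURCE.**  Coarse `X = S + (G₁V)X`, fine `X′ = S′ + (G₁′V′)X′` (entry 2 of (3.42): `S = G₁∇*`, the SAME step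
`G₁V`); binders: the fine step `G₁′V′ ≤ N′` (`‖N′‖_ρ ≤ m′`, `κ′m′ < 1`; SHAPE (3.63)), the coarse `VX ≤ A_V e^{−(ρ+σ)d}`, the `U ≡ 1` defects `𝔇(S′,S) ≤ N_S w`
(`‖N_S‖_ρ ≤ m_S`; NE2⁰'s entry of the source) and `𝔇(G₁′,G₁) ≤ N_G w` (`‖N_G‖_ρ ≤ m_G`; NE2⁰'s entry 0), the sandwiched perturbation defect
`G₁′∘𝔇(V′,V)∘X ≤ c_V e^{−ρd}w`, a priori `M₀w`.  THEN `𝔇(X′,X) ≤ (m_S + κm_G A_V C + c_V)(1 − κ′m′)⁻¹·e^{−ρd}·w(y′)`.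
[cite: Balaban1985BackgroundPropagators, (3.63)–(3.65) pp.402–403 (mechanism)] -/
theorem idef_source_step_majorant
    {b₁ : BlockNorm g F₁} {b₂' : BlockNorm g F₂'}
    {τ₁ : F₁ →ₗ[ℝ] F₁'} {τ₂ : F₂ →ₗ[ℝ] F₂'}
    {S G₁ Xc : F₁ →ₗ[ℝ] F₂} {V : F₂ →ₗ[ℝ] F₁} {S' G₁' Xf : F₁' →ₗ[ℝ] F₂'} {V' : F₂' →ₗ[ℝ] F₁'}
    {N' N_S N_G : g.Site → g.Site → ℝ} {w : g.Site → ℝ} {m' m_S m_G A_V c_V M₀ ρ σ C : ℝ}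
    (htri : Triangle254 g) (hd : ∀ a b : g.Site, 0 ≤ g.dist a b) (hρ : 0 ≤ ρ)
    (hw : ∀ y, 0 ≤ w y) (hsw : SlowWeight g σ C w) (hC : 0 ≤ C) (hAV : 0 ≤ A_V) (hcV : 0 ≤ c_V) (hM₀ : 0 ≤ M₀)
    (hN' : ∀ x y, 0 ≤ N' x y) (hm' : WRow g ρ N' m') (hNS : ∀ x y, 0 ≤ N_S x y) (hmS : WRow g ρ N_S m_S)
    (hNG : ∀ x y, 0 ≤ N_G x y) (hmG : WRow g ρ N_G m_G)
    (hfix : Xc = S + (G₁ ∘ₗ V) ∘ₗ Xc) (hfix' : Xf = S' + (G₁' ∘ₗ V') ∘ₗ Xf)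
    (hK' : HasMaj b₂' b₂' (G₁' ∘ₗ V') N')
    (hVX : HasMaj b₁ b₁ (V ∘ₗ Xc) (fun y y' => A_V * Real.exp (-((ρ + σ) * g.dist y y'))))
    (hDS : HasMaj b₁ b₂' (idef τ₁ τ₂ S' S) (fun y y' => N_S y y' * w y'))
    (hDG : HasMaj b₁ b₂' (idef τ₁ τ₂ G₁' G₁) (fun y y' => N_G y y' * w y'))
    (hDV : HasMaj b₁ b₂' (G₁' ∘ₗ idef τ₂ τ₁ V' V ∘ₗ Xc) (fun y y' => c_V * Real.exp (-(ρ * g.dist y y')) * w y'))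
    (hap : HasMaj b₁ b₂' (idef τ₁ τ₂ Xf Xc) (fun _ y' => M₀ * w y'))
    (hq' : b₂'.κ * m' < 1) :
    HasMaj b₁ b₂' (idef τ₁ τ₂ Xf Xc)
      (fun y y' => (m_S + b₁.κ * m_G * A_V * C + c_V) * (1 - b₂'.κ * m')⁻¹ * Real.exp (-(ρ * g.dist y y')) * w y') := by
  have hDS' : HasMaj b₁ b₂' (idef τ₁ τ₂ S' S) (fun y y' => m_S * Real.exp (-(ρ * g.dist y y')) * w y') :=
    hDS.mono fun y y' => mul_le_mul_of_nonneg_right (hmS.pointwise hNS y y') (hw y')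
  have hDGV : HasMaj b₁ b₂' (idef τ₁ τ₂ G₁' G₁ ∘ₗ (V ∘ₗ Xc))
      (fun y y' => b₁.κ * m_G * A_V * C * Real.exp (-(ρ * g.dist y y')) * w y') :=
    hasMaj_comp_transfer htri hρ hAV hC hNG hw hsw hmG hDG hVX
  have hsrc : HasMaj b₁ b₂' (idef τ₁ τ₂ S' S + idef τ₂ τ₂ (G₁' ∘ₗ V') (G₁ ∘ₗ V) ∘ₗ Xc)
      (fun y y' => (m_S + b₁.κ * m_G * A_V * C + c_V) * Real.exp (-(ρ * g.dist y y')) * w y') := by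
    rw [idef_step_comp_eq, ← add_assoc]
    refine ((hDS'.add hDV).add hDGV).mono fun y y' => le_of_eq ?_
    ring
  intro y₀' μ₀ hμ₀ y₀
  have hmS0 : 0 ≤ m_S := hmS.nonneg hNS y₀
  have hmG0 : 0 ≤ m_G := hmG.nonneg hNG y₀
  have hc : 0 ≤ m_S + b₁.κ * m_G * A_V * C + c_V :=
    add_nonneg (add_nonneg hmS0 (mul_nonneg (mul_nonneg (mul_nonneg b₁.κ_nonneg hmG0) hAV) hC)) hcV
  exact idef_neumann_majorant_of_source htri hd hρ hw hc hM₀ hN' hm' hfix hfix' hK' hsrc hap hq' y₀' μ₀ hμ₀ y₀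

/-! ## §2 Derived entries: the exact identity -/

/-- **DERIVED ENTRY, EXACT.**  For `Y = D₁ + (D₁∘V)∘X` (coarse; `D₁ = PG₁` the entry's outer operation applied to the `U ≡ 1` propagator, `X` the
background propagator) and `Y′ = D₁′ + (D₁′∘V′)∘X′` (fine):
`𝔇(Y′, Y) = 𝔇(D₁′,D₁) + 𝔇(D₁′,D₁)∘(V∘X) + (D₁′∘V′)∘𝔇(X′,X) + D₁′∘𝔇(V′,V)∘X` — no derivative ever hits a pulled-back function. [folklore] -/
theorem idef_derived_entry_eq (τ₁ : F₁ →ₗ[ℝ] F₁') (τ₂ : F₂ →ₗ[ℝ] F₂') (τ₃ : F₃ →ₗ[ℝ] F₃')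
    {D₁ Y : F₁ →ₗ[ℝ] F₃} {V : F₂ →ₗ[ℝ] F₁} {Xc : F₁ →ₗ[ℝ] F₂} {D₁' Y' : F₁' →ₗ[ℝ] F₃'} {V' : F₂' →ₗ[ℝ] F₁'} {Xf : F₁' →ₗ[ℝ] F₂'}
    (hY : Y = D₁ + (D₁ ∘ₗ V) ∘ₗ Xc) (hY' : Y' = D₁' + (D₁' ∘ₗ V') ∘ₗ Xf) :
    idef τ₁ τ₃ Y' Y =
      idef τ₁ τ₃ D₁' D₁ + idef τ₁ τ₃ D₁' D₁ ∘ₗ (V ∘ₗ Xc) + (D₁' ∘ₗ V') ∘ₗ idef τ₁ τ₂ Xf Xc +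
        D₁' ∘ₗ idef τ₂ τ₁ V' V ∘ₗ Xc := by
  rw [hY, hY', idef_add, idef_comp τ₁ τ₂ τ₃ (D₁' ∘ₗ V') Xf (D₁ ∘ₗ V) Xc, idef_comp τ₂ τ₁ τ₃ D₁' V' D₁ V]
  ext v
  simp only [LinearMap.add_apply, LinearMap.comp_apply]
  abel

/-! ## §3 Derived entries: the majorant (entries 1 and 3: `D₁ = ∇G₁`, `ΔG₁`) -/

/-- **DERIVED ENTRY, MAJORANT.**  Binders: the `U ≡ 1` defect of the derived entry `𝔇(D₁′,D₁) ≤ N_D w` (`‖N_D‖_ρ ≤ m_D`; NE2⁰'s entry 1∕3 — King's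
(3.73) derivative kernel has its own rate), the coarse `VX ≤ A_V e^{−(ρ+σ)d}`, the fine `D₁′V′ ≤ N_{DV}` (`‖N_{DV}‖_ρ ≤ m_{DV}`; SHAPE (3.63) with the derivative
entry), the ENTRY-0 DEFECT `𝔇(X′,X) ≤ c_X e^{−ρd}w` (= `idef_background_propagator_majorant`), and the SANDWICHED perturbation defect with the left factor `D₁′`,
`D₁′∘𝔇(V′,V)∘X ≤ c_{DV} e^{−ρd}w` (this seat's `…N15FirstOrderDefect` with the left factor's adjoint-derivative entry `D₁′∇′*` = the (3.44)-SHAPED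
`|∇_U G′∇*_U λ|` for `P = ∇`); slow weight `w`.  THEN `𝔇(Y′,Y) ≤ (m_D + κm_D A_V C + κ′m_{DV}c_X + c_{DV})·e^{−ρd(y,y′)}·w(y′)`.
[cite: Balaban1985BackgroundPropagators, Thm 3.1 (3.42) + (3.44) p.397 (entries: shapes); King1986, Prop. 3.9 (3.73) p.665 (separate rate of the derivative kernel: shape)] -/
theorem idef_derived_entry_majorant
    {b₁ : BlockNorm g F₁} {b₂' : BlockNorm g F₂'} {b₃' : BlockNorm g F₃'}
    (τ₁ : F₁ →ₗ[ℝ] F₁') (τ₂ : F₂ →ₗ[ℝ] F₂') (τ₃ : F₃ →ₗ[ℝ] F₃')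
    {D₁ Y : F₁ →ₗ[ℝ] F₃} {V : F₂ →ₗ[ℝ] F₁} {Xc : F₁ →ₗ[ℝ] F₂} {D₁' Y' : F₁' →ₗ[ℝ] F₃'} {V' : F₂' →ₗ[ℝ] F₁'} {Xf : F₁' →ₗ[ℝ] F₂'}
    {N_D N_DV : g.Site → g.Site → ℝ} {w : g.Site → ℝ} {m_D m_DV A_V c_X c_DV ρ σ C : ℝ}
    (htri : Triangle254 g) (hρ : 0 ≤ ρ) (hw : ∀ y, 0 ≤ w y) (hsw : SlowWeight g σ C w) (hC : 0 ≤ C)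
    (hAV : 0 ≤ A_V) (hcX : 0 ≤ c_X)
    (hND : ∀ x y, 0 ≤ N_D x y) (hmD : WRow g ρ N_D m_D) (hNDV : ∀ x y, 0 ≤ N_DV x y) (hmDV : WRow g ρ N_DV m_DV)
    (hY : Y = D₁ + (D₁ ∘ₗ V) ∘ₗ Xc) (hY' : Y' = D₁' + (D₁' ∘ₗ V') ∘ₗ Xf)
    (hDD : HasMaj b₁ b₃' (idef τ₁ τ₃ D₁' D₁) (fun y y' => N_D y y' * w y'))
    (hVX : HasMaj b₁ b₁ (V ∘ₗ Xc) (fun y y' => A_V * Real.exp (-((ρ + σ) * g.dist y y'))))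
    (hDV' : HasMaj b₂' b₃' (D₁' ∘ₗ V') N_DV)
    (hDX : HasMaj b₁ b₂' (idef τ₁ τ₂ Xf Xc) (fun y y' => c_X * Real.exp (-(ρ * g.dist y y')) * w y'))
    (hsand : HasMaj b₁ b₃' (D₁' ∘ₗ idef τ₂ τ₁ V' V ∘ₗ Xc) (fun y y' => c_DV * Real.exp (-(ρ * g.dist y y')) * w y')) :
    HasMaj b₁ b₃' (idef τ₁ τ₃ Y' Y)
      (fun y y' => (m_D + b₁.κ * m_D * A_V * C + b₂'.κ * m_DV * c_X + c_DV) * Real.exp (-(ρ * g.dist y y')) * w y') := by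
  -- (1) the U ≡ 1 defect of the derived entry, pointwise from its weighted row norm
  have h1 : HasMaj b₁ b₃' (idef τ₁ τ₃ D₁' D₁) (fun y y' => m_D * Real.exp (-(ρ * g.dist y y')) * w y') :=
    hDD.mono fun y y' => mul_le_mul_of_nonneg_right (hmD.pointwise hND y y') (hw y')
  -- (2) the same against the coarse VX: the located rate loss
  have h2 : HasMaj b₁ b₃' (idef τ₁ τ₃ D₁' D₁ ∘ₗ (V ∘ₗ Xc))
      (fun y y' => b₁.κ * m_D * A_V * C * Real.exp (-(ρ * g.dist y y')) * w y') :=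
    hasMaj_comp_transfer htri hρ hAV hC hND hw hsw hmD hDD hVX
  -- (3) the fine D₁′V′ after the entry-0 defect: the source weight rides through for free
  have h3 : HasMaj b₁ b₃' ((D₁' ∘ₗ V') ∘ₗ idef τ₁ τ₂ Xf Xc)
      (fun y y' => b₂'.κ * m_DV * c_X * Real.exp (-(ρ * g.dist y y')) * w y') :=
    hasMaj_comp_wrow_source htri hρ hcX hNDV hw hmDV hDV' hDX
  rw [idef_derived_entry_eq τ₁ τ₂ τ₃ hY hY']
  refine (((h1.add h2).add h3).add hsand).mono fun y y' => le_of_eq ?_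
  ring

/-- THE FLAT-WEIGHT READING of the derived-entry majorant (`w ≡ 1`, `σ = 0`, `C = 1`). [folklore] -/
theorem idef_derived_entry_majorant_flat
    {b₁ : BlockNorm g F₁} {b₂' : BlockNorm g F₂'} {b₃' : BlockNorm g F₃'}
    (τ₁ : F₁ →ₗ[ℝ] F₁') (τ₂ : F₂ →ₗ[ℝ] F₂') (τ₃ : F₃ →ₗ[ℝ] F₃')
    {D₁ Y : F₁ →ₗ[ℝ] F₃} {V : F₂ →ₗ[ℝ] F₁} {Xc : F₁ →ₗ[ℝ] F₂} {D₁' Y' : F₁' →ₗ[ℝ] F₃'} {V' : F₂' →ₗ[ℝ] F₁'} {Xf : F₁' →ₗ[ℝ] F₂'}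
    {N_D N_DV : g.Site → g.Site → ℝ} {m_D m_DV A_V c_X c_DV ρ : ℝ}
    (htri : Triangle254 g) (hρ : 0 ≤ ρ) (hAV : 0 ≤ A_V) (hcX : 0 ≤ c_X)
    (hND : ∀ x y, 0 ≤ N_D x y) (hmD : WRow g ρ N_D m_D) (hNDV : ∀ x y, 0 ≤ N_DV x y) (hmDV : WRow g ρ N_DV m_DV)
    (hY : Y = D₁ + (D₁ ∘ₗ V) ∘ₗ Xc) (hY' : Y' = D₁' + (D₁' ∘ₗ V') ∘ₗ Xf)
    (hDD : HasMaj b₁ b₃' (idef τ₁ τ₃ D₁' D₁) N_D)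
    (hVX : HasMaj b₁ b₁ (V ∘ₗ Xc) (fun y y' => A_V * Real.exp (-(ρ * g.dist y y'))))
    (hDV' : HasMaj b₂' b₃' (D₁' ∘ₗ V') N_DV)
    (hDX : HasMaj b₁ b₂' (idef τ₁ τ₂ Xf Xc) (fun y y' => c_X * Real.exp (-(ρ * g.dist y y'))))
    (hsand : HasMaj b₁ b₃' (D₁' ∘ₗ idef τ₂ τ₁ V' V ∘ₗ Xc) (fun y y' => c_DV * Real.exp (-(ρ * g.dist y y')))) :
    HasMaj b₁ b₃' (idef τ₁ τ₃ Y' Y)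
      (fun y y' => (m_D + b₁.κ * m_D * A_V + b₂'.κ * m_DV * c_X + c_DV) * Real.exp (-(ρ * g.dist y y'))) := by
  have key := idef_derived_entry_majorant (w := fun _ => (1 : ℝ)) (σ := 0) (C := 1) τ₁ τ₂ τ₃ htri hρ (fun _ => zero_le_one)
    (slowWeight_const 1) zero_le_one hAV hcX hND hmD hNDV hmDV hY hY' (by simpa only [mul_one] using hDD)
    (by simpa only [add_zero] using hVX) hDV' (by simpa only [mul_one] using hDX) (by simpa only [mul_one] using hsand)
  simpa only [mul_one] using key

end Summit.QuantumFields.YangMills.BalabanUVNodes.N15.BackgroundStep
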